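import Literature.AlgebraicGeometry.RelativeSpec.SymmetricPowerGlued
import Literature.AlgebraicGeometry.RelativeSpec.FreeQuotient
import Mathlib.RingTheory.Adjoin.Tower
import Mathlib.AlgebraicGeometry.Morphisms.Finite
import Mathlib.AlgebraicGeometry.Morphisms.Proper
import HarnessLib

/-!
# Quotients of schemes by finite groups, glued case: integrality, finite type, finiteness of `π`,
# properness of descended maps (SGA 1, Exp. V, §1; Mumford, *Abelian Varieties*, §7)

Complements to `…RelativeSpec.FiniteGroupQuotientGluing` (the quotient `X/G = ActionOver.glued`
of a scheme `X` separated over a separated base `Y` by a finite group `G` acting over `Y`, when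
`X` is covered by `G`-stable opens affine over `Y`) and `…RelativeSpec.SymmetricPowerGlued`
(`π : X → X/G` integral; descended maps separated). Everything here is the standard list of
properties of `X/G` in SGA 1, Exp. V, Prop. 1.1, Cor. 1.5 and Prop. 1.8, and Mumford, AV §7, Thm.
p. 66:

* `ActionOver.isIntegral_glued` — `X/G` is integral when `X` is;
* `SubringDatum.of_fromSpec_of_forall_specMap` — target-local properties of the structure map
  `Spec_Y(D) → Y` of a relative spectrum are checked on the charts `Spec (D.ring U) → U`;
* `ActionOver.finiteType_diagramMap_invariants` — for `r : X → Y` affine of finite type over a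
  locally noetherian `Y`, `Γ(Y, U) → Γ(X, r⁻¹U)^G` is of finite type (E. Noether / Artin–Tate:
  `Γ(X, r⁻¹U)` is integral and of finite type, hence finite, over its invariants; Mathlib
  `fg_of_fg_of_fg`), whence `ActionOver.locallyOfFiniteType_quotientToBase` (affine case) and
  `ActionOver.locallyOfFiniteType_gluedDesc_base` (glued case): `X/G → Y` is locally of finite
  type (SGA 1, V, Cor. 1.5);
* `ActionOver.isFinite_gluedMk` — `π : X → X/G` is FINITE when `r` is locally of finite type
  over a locally noetherian base (integral + locally of finite type);
* `ActionOver.isProper_gluedDesc`, `ActionOver.surjective_gluedDesc` — the morphism `X/G → Z`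
  induced by a proper (resp. surjective) invariant `X → Z` is proper (resp. surjective).

Everything is proved; no named facts (D-0026).

## References

* A. Grothendieck, *SGA 1*, Exp. V, §1: Prop. 1.1, Cor. 1.5, Prop. 1.8. [SGA1]
* D. Mumford, *Abelian Varieties* (1970), §7, Thm. p. 66. [MumfordAV1970]
-/

noncomputable section

universe u

open CategoryTheory Limits AlgebraicGeometry

namespace Literature.AlgebraicGeometry.RelativeSpec

/-! ### Target-local properties of the structure map of a relative spectrum -/

namespace SubringDatum

variable {X Y : Scheme.{u}} {f : X ⟶ Y} (D : SubringDatum f) [QuasiCompact f] [QuasiSeparated f]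

set_option backward.isDefEq.respectTransparency false in
/-- **Checking a property of `fromSpec : Spec_Y(D.ring) ⟶ Y` on the charts.** A Zariski-local
(on the target) property holds for `fromSpec` as soon as it holds for the maps of affine schemes
`Spec (D.ring U) → Spec Γ(Y, U)`, `U ⊆ Y` affine open (over the chart `U`, `fromSpec` *is*
that map; cf. `isFinite_fromSpec`, Mathlib `fromNormalization`). [folklore] -/
theorem of_fromSpec_of_forall_specMap (P : MorphismProperty Scheme.{u}) [IsZariskiLocalAtTarget P]
    (h : ∀ U : Y.affineOpens, P (Spec.map (D.diagramMap.app (.op U.1)))) : P D.fromSpec := by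
  rw [IsZariskiLocalAtTarget.iff_of_iSup_eq_top (P := P) _ (iSup_affineOpens_eq_top _)]
  intro U
  let e := IsOpenImmersion.isoOfRangeEq (D.fromSpec ⁻¹ᵁ U).ι (D.openCover.f U)
      (by simpa using congr($(D.fromSpec_preimage U).1))
  rw [← MorphismProperty.cancel_left_of_respectsIso P e.inv,
    ← MorphismProperty.cancel_right_of_respectsIso P _ U.2.isoSpec.hom]
  convert! h U
  rw [← cancel_mono U.2.fromSpec]
  simp [IsAffineOpen.isoSpec_hom, e, ι_fromSpec]

end SubringDatum

namespace ActionOver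

/-! ### Invariants of finite type (E. Noether; Artin–Tate) -/

section FiniteType

variable {X Y : Scheme.{u}} {r : X ⟶ Y} {G : Type*} [Group G] (ρ : ActionOver r G) [Finite G]

/-- **Invariants of a finite group in an algebra of finite type are of finite type** (E. Noether;
via Artin–Tate, Mathlib `fg_of_fg_of_fg`): for `r : X → Y` affine and locally of finite type,
`Y` locally noetherian and `U ⊆ Y` affine open, the structure map `Γ(Y, U) → Γ(X, r⁻¹U)^G` is of
finite type — `Γ(X, r⁻¹U)` is of finite type over `Γ(Y, U)`, and integral (Mathlib
`Algebra.IsInvariant.isIntegral`) hence finite over its ring of invariants.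
[cite: SGA1, Exp. V, Cor. 1.5] -/
theorem finiteType_diagramMap_invariants [IsAffineHom r] [LocallyOfFiniteType r]
    [IsLocallyNoetherian Y] (U : Y.affineOpens) :
    (ρ.invariants.diagramMap.app (.op U.1)).hom.FiniteType := by
  classical
  -- the three rings `A = Γ(Y, U)`, `B = Γ(X, r⁻¹U)^G`, `C = Γ(X, r⁻¹U)`
  letI := ρ.mulSemiringAction U.1
  haveI := ρ.isInvariant_invariantsRing U.1
  letI algAC : Algebra Γ(Y, U.1) Γ(X, r ⁻¹ᵁ U.1) := (r.app U.1).hom.toAlgebra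
  letI algAB : Algebra Γ(Y, U.1) (ρ.invariantsRing U.1) :=
    (ρ.invariants.diagramMap.app (.op U.1)).hom.toAlgebra
  haveI : IsScalarTower Γ(Y, U.1) (ρ.invariantsRing U.1) Γ(X, r ⁻¹ᵁ U.1) :=
    IsScalarTower.of_algebraMap_eq fun _ => rfl
  haveI : IsNoetherianRing Γ(Y, U.1) := IsLocallyNoetherian.component_noetherian U
  -- `C` is of finite type over `A`
  have hAC : Algebra.FiniteType Γ(Y, U.1) Γ(X, r ⁻¹ᵁ U.1) := by
    have h := r.finiteType_appLE U.2 (U.2.preimage r) le_rfl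
    rw [← Scheme.Hom.app_eq_appLE] at h
    exact h
  -- `C` is integral over `B`, hence finite (it is of finite type over `B` as it is over `A`)
  haveI : Algebra.IsIntegral (ρ.invariantsRing U.1) Γ(X, r ⁻¹ᵁ U.1) :=
    Algebra.IsInvariant.isIntegral (ρ.invariantsRing U.1) Γ(X, r ⁻¹ᵁ U.1) G
  haveI : Algebra.FiniteType (ρ.invariantsRing U.1) Γ(X, r ⁻¹ᵁ U.1) :=
    Algebra.FiniteType.of_restrictScalars_finiteType Γ(Y, U.1) _ _
  haveI : Module.Finite (ρ.invariantsRing U.1) Γ(X, r ⁻¹ᵁ U.1) :=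
    Algebra.IsIntegral.finite
  have hfg : (⊤ : Subalgebra Γ(Y, U.1) (ρ.invariantsRing U.1)).FG :=
    fg_of_fg_of_fg Γ(Y, U.1) (ρ.invariantsRing U.1) Γ(X, r ⁻¹ᵁ U.1) hAC.out
      Module.Finite.fg_top Subtype.val_injective
  change @Algebra.FiniteType Γ(Y, U.1) (ρ.invariantsRing U.1) _ _ algAB
  exact ⟨hfg⟩

/-- **`X/G → Y` is locally of finite type** in the affine case (`r` affine, locally of finite
type, `Y` locally noetherian): chart by chart this is `finiteType_diagramMap_invariants`.
[cite: SGA1, Exp. V, Cor. 1.5] -/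
theorem locallyOfFiniteType_quotientToBase [IsAffineHom r] [LocallyOfFiniteType r]
    [IsLocallyNoetherian Y] : LocallyOfFiniteType ρ.quotientToBase :=
  ρ.invariants.of_fromSpec_of_forall_specMap @LocallyOfFiniteType fun U =>
    (HasRingHomProperty.Spec_iff (P := @LocallyOfFiniteType)).mpr
      (ρ.finiteType_diagramMap_invariants U)

end FiniteType

/-! ### The glued quotient: integrality, finite type over the base, finiteness of `π` -/

section Glued

variable {X Y : Scheme.{u}} {r : X ⟶ Y} {G : Type*} [Group G] (ρ : ActionOver r G)
  [Finite G] [Y.IsSeparated] [IsSeparated r]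
  (hcov : ∀ x : X, ∃ O : ρ.StableAffineOpens, x ∈ O.1)

/-- **`X/G` is reduced when `X` is**: it is covered by the charts `O/G`, relative spectra of
subrings of rings of sections of the reduced `O` (`SubringDatum.isReduced_spec`). [folklore] -/
theorem isReduced_glued [IsReduced X] : IsReduced ρ.glued := by
  haveI : ∀ O, IsReduced ((Scheme.IsLocallyDirected.openCover ρ.glueFunctor).X O) := fun O =>
    show IsReduced (ρ.pieceQuot O) from (ρ.restrict O.1 O.2.1).invariants.isReduced_spec
  exact IsReduced.of_openCover ρ.glued (Scheme.IsLocallyDirected.openCover ρ.glueFunctor)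

include hcov in
/-- **`X/G` is integral when `X` is** (SGA 1, V, Prop. 1.1: `𝒪_{X/G} = (π_* 𝒪_X)^G ⊆ π_* 𝒪_X`,
and `X → X/G` is surjective): reduced by `isReduced_glued`, irreducible as the image of `X` under
the surjective `π`. [cite: SGA1, Exp. V, Prop. 1.1] -/
theorem isIntegral_glued [IsIntegral X] : IsIntegral ρ.glued := by
  haveI := ρ.isReduced_glued
  haveI : IrreducibleSpace ρ.glued := by
    rw [irreducibleSpace_def]
    have h := (IrreducibleSpace.isIrreducible_univ X).image _
      (ρ.gluedMk hcov).continuous.continuousOn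
    rwa [Set.image_univ, (ρ.gluedMk_surjective hcov).range_eq] at h
  exact isIntegral_of_irreducibleSpace_of_isReduced _

/-- On the chart `O/G ↪ X/G`, the morphism `X/G → Y` descended from `r` is the structure map
`O/G → Y` of the affine quotient. [folklore] -/
theorem gluedι_gluedDesc_base (O : ρ.StableAffineOpens) :
    ρ.gluedι O ≫ ρ.gluedDesc r ρ.aut_comp = (ρ.restrict O.1 O.2.1).quotientToBase := by
  rw [ρ.gluedι_gluedDesc]
  change (ρ.restrict O.1 O.2.1).desc (O.1.ι ≫ r) _ = _
  exact ((ρ.restrict O.1 O.2.1).eq_desc (O.1.ι ≫ r) (ρ.restrict_invariant O r ρ.aut_comp)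
    (ρ.restrict O.1 O.2.1).quotientToBase (ρ.restrict O.1 O.2.1).toQuotient_quotientToBase).symm

/-- **`X/G → Y` is locally of finite type** when `r : X → Y` is locally of finite type and `Y` is
locally noetherian (SGA 1, V, Cor. 1.5): on each chart `O/G` it is the structure map of an
affine quotient, of finite type by E. Noether / Artin–Tate (`locallyOfFiniteType_quotientToBase`).
[cite: SGA1, Exp. V, Cor. 1.5] -/
theorem locallyOfFiniteType_gluedDesc_base [LocallyOfFiniteType r] [IsLocallyNoetherian Y] :
    LocallyOfFiniteType (ρ.gluedDesc r ρ.aut_comp) := by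
  refine (IsZariskiLocalAtSource.iff_of_openCover (P := @LocallyOfFiniteType)
    (f := ρ.gluedDesc r ρ.aut_comp) (Scheme.IsLocallyDirected.openCover ρ.glueFunctor)).mpr
    fun O => ?_
  change LocallyOfFiniteType (ρ.gluedι O ≫ ρ.gluedDesc r ρ.aut_comp)
  rw [ρ.gluedι_gluedDesc_base O]
  haveI : LocallyOfFiniteType (O.1.ι ≫ r) := inferInstance
  exact (ρ.restrict O.1 O.2.1).locallyOfFiniteType_quotientToBase

include hcov in
/-- `π ≫ (X/G → Y) = r`, so `π` is locally of finite type when `r` is. [folklore] -/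
theorem locallyOfFiniteType_gluedMk [LocallyOfFiniteType r] :
    LocallyOfFiniteType (ρ.gluedMk hcov) := by
  have h : LocallyOfFiniteType (ρ.gluedMk hcov ≫ ρ.gluedDesc r ρ.aut_comp) := by
    rw [ρ.gluedMk_gluedDesc hcov]; infer_instance
  exact locallyOfFiniteType_of_comp _ (ρ.gluedDesc r ρ.aut_comp)

/-- **`π : X → X/G` is finite** when `r` is locally of finite type (integral, `isIntegralHom_gluedMk`,
and locally of finite type). [cite: SGA1, Exp. V, Prop. 1.1 and Cor. 1.5] -/
theorem isFinite_gluedMk [LocallyOfFiniteType r] : IsFinite (ρ.gluedMk hcov) :=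
  (IsFinite.iff_isIntegralHom_and_locallyOfFiniteType _).mpr
    ⟨inferInstance, ρ.locallyOfFiniteType_gluedMk hcov⟩

/-- If `f ≫ g` is quasi-compact and `f` is surjective then `g` is quasi-compact (preimages
under `g` are images under `f` of preimages under `f ≫ g`). [folklore] -/
theorem _root_.Literature.AlgebraicGeometry.RelativeSpec.quasiCompact_of_comp_surjective
    {X Y Z : Scheme.{u}} (f : X ⟶ Y) (g : Y ⟶ Z) [QuasiCompact (f ≫ g)] [Surjective f] :
    QuasiCompact g := by
  refine ⟨fun U hU hUc => ?_⟩
  have h : g ⁻¹' U = f '' ((f ≫ g) ⁻¹' U) := by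
    rw [Scheme.Hom.comp_base, TopCat.coe_comp, Set.preimage_comp,
      Set.image_preimage_eq _ f.surjective]
  rw [h]
  exact (QuasiCompact.isCompact_preimage _ hU hUc).image f.continuous

include hcov in
/-- **`X/G → Y` is quasi-compact** when `r` is: `π` is surjective and `π ≫ (X/G → Y) = r`.
[folklore] -/
theorem quasiCompact_gluedDesc_base [QuasiCompact r] : QuasiCompact (ρ.gluedDesc r ρ.aut_comp) := by
  have h : QuasiCompact (ρ.gluedMk hcov ≫ ρ.gluedDesc r ρ.aut_comp) := by
    rw [ρ.gluedMk_gluedDesc hcov]; infer_instance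
  exact quasiCompact_of_comp_surjective (ρ.gluedMk hcov) _

/-! ### Descending proper and surjective invariant morphisms -/

variable {Z : Scheme.{u}} [Z.IsSeparated] (f : X ⟶ Z) (hf : ∀ g : G, (ρ.aut g).hom ≫ f = f)

include hcov in
/-- **The morphism `X/G → Z` induced by a surjective invariant `X → Z` is surjective.**
[folklore] -/
theorem surjective_gluedDesc [Surjective f] : Surjective (ρ.gluedDesc f hf) := by
  have h : Surjective (ρ.gluedMk hcov ≫ ρ.gluedDesc f hf) := by
    rw [ρ.gluedMk_gluedDesc hcov]; infer_instance
  exact Surjective.of_comp (ρ.gluedMk hcov) _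

include hcov in
/-- **The morphism `X/G → Z` induced by a universally closed invariant `X → Z` is universally
closed** (`π` is surjective). [folklore] -/
theorem universallyClosed_gluedDesc [UniversallyClosed f] :
    UniversallyClosed (ρ.gluedDesc f hf) := by
  have h : UniversallyClosed (ρ.gluedMk hcov ≫ ρ.gluedDesc f hf) := by
    rw [ρ.gluedMk_gluedDesc hcov]; infer_instance
  exact UniversallyClosed.of_comp_surjective (ρ.gluedMk hcov) _

include hcov in
/-- **The morphism `X/G → Z` induced by a PROPER invariant `X → Z` is proper**, provided
`r : X → Y` is locally of finite type over a locally noetherian `Y` and `Z` is a `Y`-scheme under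
`f` (`f ≫ t = r` for some `t : Z → Y`): separated (`isSeparated_gluedDesc`), universally closed
(`universallyClosed_gluedDesc`), and locally of finite type because `X/G → Y` is
(`locallyOfFiniteType_gluedDesc_base`) and factors through `X/G → Z`. [cite: SGA1, Exp. V, Cor. 1.5] -/
theorem isProper_gluedDesc [IsProper f] [LocallyOfFiniteType r] [IsLocallyNoetherian Y]
    (t : Z ⟶ Y) (ht : f ≫ t = r) : IsProper (ρ.gluedDesc f hf) := by
  haveI := ρ.isSeparated_gluedDesc hcov f hf
  haveI := ρ.universallyClosed_gluedDesc hcov f hf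
  haveI : LocallyOfFiniteType (ρ.gluedDesc f hf) := by
    have e : ρ.gluedDesc f hf ≫ t = ρ.gluedDesc r ρ.aut_comp :=
      ρ.glued_hom_ext hcov (by rw [ρ.gluedMk_gluedDesc_assoc, ht, ρ.gluedMk_gluedDesc])
    have h : LocallyOfFiniteType (ρ.gluedDesc f hf ≫ t) := by
      rw [e]; exact ρ.locallyOfFiniteType_gluedDesc_base
    exact locallyOfFiniteType_of_comp _ t
  exact {}

end Glued

end ActionOver

end Literature.AlgebraicGeometry.RelativeSpec

end
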